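import Summits.ResolutionOfSingularities.ResolutionOfSingularities.Theorems.UniformComplexityCampaignW82TwistExponentAlgebra
import Mathlib.RingTheory.TensorProduct.Quotient
import Mathlib.RingTheory.TensorProduct.MvPolynomial
import Mathlib.RingTheory.IntegralClosure.IsIntegralClosure.Basic
import Literature.AlgebraicGeometry.Resolution.RegularLocalRingsJacobian
import HarnessLib

/-!
# [OURS · L1 W8.2] The twist-exponent witness `y^q = (x^p − t)^N`, II: normalisation and the cusp

Cell `res-hironaka`, LADDER-RESOLUTION rung L (RESCUE), slot W8.2, door 2 (`UniformComplexity`, host item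
`PrimeModelTransfer` stmt-ResolutionOfSingularities-8933); prover res-L1-s82-pv-2 (gen 3). THESES-FREE module
(imports the sibling `…TwistExponentAlgebra`, the tree's Jacobian criterion
`Literature.AlgebraicGeometry.Resolution.not_isRegularLocalRing_localization_of_pderiv_eval_eq_zero`, Mathlib,
`HarnessLib`).

[OURS · L1 W8.2] NEGATIVE-SIDE INFRASTRUCTURE (continued) for the curves `C_N : y^q = (x^p − t)^N`:

* §4 `normMap K p t q N : A_N →ₐ[K] A_1`, `y ↦ w^N`, `x ↦ x` — the (birational, for `gcd(q,N) = 1`)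
  normalisation map onto Kollár's curve `A_1 = K[x,w]/(w^q − (x^p − t))`; `isIntegral_normMap`
  (`A_1` is integral over `A_N`: `w^q = ḡ`); the classes `xElt`, `gElt_eq` (`ḡ = x^p − t`), `gElt_ne_zero`.
* §5 `eq_QIdeal_one_of_comap_normMap`: `Q_1 = (w)` is the ONLY prime of `A_1` over the point `P_N` of `A_N`.
* §6 base change to a field `L ⊇ K` containing `τ` with `τ^p = t`: `TwistRingExt = L[X₀,X₁]/(f_1)`, the
  `L`-point `(0, τ)` (`cuspIdeal`), `not_isRegularLocalRing_cusp` (Jacobian criterion: `f`, `∂f/∂X₀ =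
  q X₀^{q−1}`, `∂f/∂X₁ = −p X₁^{p−1} = 0` all vanish at `(0, τ)`), the explicit ring isomorphism
  `tensorEquiv : A_1 ⊗_K L ≃+* L[X₀,X₁]/(f_1)` (Mathlib `tensorQuotientEquiv` + `algebraTensorAlgEquiv`) with
  `tensorEquiv_comp_includeLeft`, and `comap_baseChangeHom_cuspIdeal`: the cusp lies over `Q_1`. This is
  the computation of the barrier file `RegularNotGeometricallyRegular.lean` (§2–§3 there, over `𝔽_p(t)` and
  `𝔽_p(t^{1/p})`), redone over an arbitrary ground field `K` and extension `L ∋ t^{1/p}`.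

HONEST FRAMING. OURS bookkeeping towards an OURS negative rung; NOT a statement of H. Hironaka's 2017
manuscript ([Hironaka2017]); nothing here is attributed to its author. AI work, weaker than expert review.

## References (vocabulary and locators only)
* J. Kollár, *Lectures on Resolution of Singularities* (2007), 1.19. [Kollar2007]
* R. Hartshorne, *Algebraic Geometry* (1977), I Thm. 5.1 (Jacobian criterion). [Hartshorne1977]
* `Literature/Barriers/ResolutionOfSingularities/RegularNotGeometricallyRegular.lean` (the `𝔽_p(t)` instance).
-/

noncomputable section

set_option linter.dupNamespace false -- mandated namespace of this single-conjunct summit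

open Polynomial
open scoped TensorProduct

namespace Summit.ResolutionOfSingularities.ResolutionOfSingularities.Theorems.CampaignW82.TwistExponent

section Curves

variable (K : Type) [Field K] (p : ℕ) (t : K) (q : ℕ)

/-! ## §4 The normalisation map `ν♯ : A_N → A_1`, `y ↦ w^N`, `x ↦ x` -/

/-- Substitution `X₀ ↦ X₀^N`, `X₁ ↦ X₁` on `K[X₀,X₁]`. [folklore] -/
def normSubst (N : ℕ) : MvPolynomial (Fin 2) K →ₐ[K] MvPolynomial (Fin 2) K :=
  MvPolynomial.aeval ![MvPolynomial.X 0 ^ N, MvPolynomial.X 1]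

/-- `f_N(X₀^N, X₁) = (X₀^q)^N − g^N`. [folklore] -/
theorem normSubst_twistPoly (N : ℕ) :
    normSubst K N (twistPoly K p t q N) = (MvPolynomial.X 0 ^ q) ^ N - gPoly K p t ^ N := by
  simp only [normSubst, twistPoly, gPoly, map_sub, map_pow, MvPolynomial.aeval_X, MvPolynomial.aeval_C,
    Matrix.cons_val_zero, Matrix.cons_val_one, Matrix.cons_val_fin_one, MvPolynomial.algebraMap_eq]
  ring

/-- `f_1 = X₀^q − g`. [folklore] -/
theorem twistPoly_one_eq : twistPoly K p t q 1 = MvPolynomial.X 0 ^ q - gPoly K p t := by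
  simp [twistPoly, gPoly]

/-- **The normalisation map** `ν♯ : A_N = K[x,y]/(y^q − g^N) → A_1 = K[x,w]/(w^q − g)`, `y ↦ w^N`,
`x ↦ x` (well defined: `w^{qN} − g^N = (w^q)^N − g^N ∈ (w^q − g)`). For `gcd(q, N) = 1` it is
birational (`w = y^b g^a` with `aq + bN = 1`), and `A_1` is the integral closure of `A_N` near the
point `P_N`. [folklore] -/
def normMap (N : ℕ) : TwistRing K p t q N →ₐ[K] TwistRing K p t q 1 :=
  Ideal.Quotient.liftₐ (Ideal.span {twistPoly K p t q N})
    ((Ideal.Quotient.mkₐ K (Ideal.span {twistPoly K p t q 1})).comp (normSubst K N))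
    (by
      intro a ha
      rw [Ideal.mem_span_singleton] at ha
      obtain ⟨c, rfl⟩ := ha
      rw [map_mul]
      refine mul_eq_zero_of_left ?_ _
      rw [AlgHom.comp_apply, Ideal.Quotient.mkₐ_eq_mk, Ideal.Quotient.eq_zero_iff_mem,
        normSubst_twistPoly, Ideal.mem_span_singleton, twistPoly_one_eq]
      exact sub_dvd_pow_sub_pow _ _ N)

/-- `ν♯` on representatives. [folklore] -/
theorem normMap_mk (N : ℕ) (h : MvPolynomial (Fin 2) K) :
    normMap K p t q N (Ideal.Quotient.mk _ h) = Ideal.Quotient.mk _ (normSubst K N h) :=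
  rfl

/-- `ν♯(y) = w^N`. [folklore] -/
theorem normMap_yElt (N : ℕ) : normMap K p t q N (yElt K p t q N) = yElt K p t q 1 ^ N := by
  rw [yElt, normMap_mk, yElt, ← map_pow]
  congr 1
  simp [normSubst]

/-- `ν♯(ḡ) = ḡ`. [folklore] -/
theorem normMap_gElt (N : ℕ) : normMap K p t q N (gElt K p t q N) = gElt K p t q 1 := by
  rw [gElt, normMap_mk, gElt]
  congr 1
  simp [normSubst, gPoly]

/-- The class `x = X̄₁ ∈ A_N`. [folklore] -/
def xElt (N : ℕ) : TwistRing K p t q N := Ideal.Quotient.mk _ (MvPolynomial.X 1)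

/-- `ḡ = x^p − t` in `A_N`. [folklore] -/
theorem gElt_eq (N : ℕ) : gElt K p t q N = xElt K p t q N ^ p - algebraMap K (TwistRing K p t q N) t := by
  simp only [gElt, gPoly, xElt, map_sub, map_pow]
  rfl

/-- `ν♯(x) = x`. [folklore] -/
theorem normMap_xElt (N : ℕ) : normMap K p t q N (xElt K p t q N) = xElt K p t q 1 := by
  rw [xElt, normMap_mk, xElt]
  congr 1
  simp [normSubst]

/-- `ḡ ≠ 0` in `A_N` (`q ≥ 1`): under `K[X₀,X₁] ≅ K[X₁][X₀]`, `f_N` is monic of degree `q ≥ 1` in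
`X₀` while `g ≠ 0` has degree `0`, so `f_N ∤ g`. [folklore] -/
theorem gElt_ne_zero [hp : Fact p.Prime] [hq : Fact q.Prime] (N : ℕ) : gElt K p t q N ≠ 0 := by
  rw [gElt, Ne, Ideal.Quotient.eq_zero_iff_mem, Ideal.mem_span_singleton]
  intro hdvd
  have h' := map_dvd (MvPolynomial.finSuccEquiv K 1) hdvd
  rw [finSuccEquiv_twistPoly] at h'
  have hg : MvPolynomial.finSuccEquiv K 1 (gPoly K p t) =
      C (MvPolynomial.X (0 : Fin 1) ^ p - MvPolynomial.C t) := by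
    have h1 : MvPolynomial.finSuccEquiv K 1 (MvPolynomial.X 1) = C (MvPolynomial.X 0) :=
      MvPolynomial.finSuccEquiv_X_succ (j := 0)
    have h2 : MvPolynomial.finSuccEquiv K 1 (MvPolynomial.C t) = C (MvPolynomial.C t) := by
      rw [MvPolynomial.finSuccEquiv_apply]; simp
    rw [map_sub, map_pow, gPoly, map_sub, map_pow, h1, h2]
  rw [hg] at h'
  have hne : (MvPolynomial.X (0 : Fin 1) ^ p - MvPolynomial.C t : MvPolynomial (Fin 1) K) ≠ 0 := by
    intro h
    have := congrArg MvPolynomial.totalDegree h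
    rw [← pow_one (MvPolynomial.X (0 : Fin 1) ^ p - MvPolynomial.C t), totalDegree_base_pow,
      MvPolynomial.totalDegree_zero] at this
    exact hp.out.ne_zero (by simpa using this)
  have hdeg := Polynomial.degree_le_of_dvd h' (Polynomial.C_ne_zero.mpr hne)
  rw [Polynomial.degree_C hne, Polynomial.degree_X_pow_sub_C hq.out.pos] at hdeg
  exact (not_le.mpr (by exact_mod_cast hq.out.pos : (0 : WithBot ℕ) < q)) hdeg

/-- Every element of `A_1` is integral over `A_N` along `ν♯` (`A_1` is generated over the image by
`w`, and `w^q = ḡ`). [folklore] -/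
theorem isIntegral_normMap [hq : Fact q.Prime] (N : ℕ) : (normMap K p t q N).toRingHom.IsIntegral := by
  intro b
  obtain ⟨h, rfl⟩ := Ideal.Quotient.mk_surjective b
  induction h using MvPolynomial.induction_on with
  | C a =>
    have : (Ideal.Quotient.mk (Ideal.span {twistPoly K p t q 1})) (MvPolynomial.C a) =
        (normMap K p t q N).toRingHom (algebraMap K (TwistRing K p t q N) a) := by
      rw [AlgHom.toRingHom_eq_coe, RingHom.coe_coe, AlgHom.commutes]; rfl
    rw [this]
    exact RingHom.isIntegralElem_map _
  | add a b ha hb => rw [map_add]; exact RingHom.IsIntegralElem.add _ ha hb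
  | mul_X h i ih =>
    rw [map_mul]
    refine RingHom.IsIntegralElem.mul _ ih ?_
    have hi : i = 0 ∨ i = 1 := by
      rcases i with ⟨i, hi⟩
      rcases i with _ | i
      · exact Or.inl rfl
      · right; ext; simp; omega
    rcases hi with rfl | rfl
    · -- `w` is a root of the monic `T^q − ḡ`
      refine ⟨X ^ q - C (gElt K p t q N), monic_X_pow_sub_C _ hq.out.ne_zero, ?_⟩
      rw [eval₂_sub, eval₂_X_pow, eval₂_C, AlgHom.toRingHom_eq_coe, RingHom.coe_coe, normMap_gElt,
        sub_eq_zero]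
      have h := yElt_pow_eq K p t q 1
      rw [pow_one] at h
      exact h
    · have : (Ideal.Quotient.mk (Ideal.span {twistPoly K p t q 1})) (MvPolynomial.X 1) =
          (normMap K p t q N).toRingHom (Ideal.Quotient.mk _ (MvPolynomial.X 1)) := by
        rw [AlgHom.toRingHom_eq_coe, RingHom.coe_coe, normMap_mk]
        congr 1
        simp [normSubst]
      rw [this]
      exact RingHom.isIntegralElem_map _

/-! ## §5 The only prime of `A_1` over `P_N` is `Q_1` -/

/-- **`Q_1` is the only prime of `A_1` lying over `Q_N`** along `ν♯` (`X^p − t` irreducible,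
`N ≥ 1`): such a prime contains `ν♯(y) = w^N`, hence `w`, hence `Q_1 = (w)`. [folklore] -/
theorem eq_QIdeal_one_of_comap_normMap [Fact q.Prime] (ht : Irreducible (X ^ p - C t : K[X]))
    {N : ℕ} (Q' : Ideal (TwistRing K p t q 1)) [hQ' : Q'.IsPrime]
    (h : Q'.comap (normMap K p t q N).toRingHom = QIdeal K p t q N) : Q' = QIdeal K p t q 1 := by
  have hy : yElt K p t q 1 ∈ Q' := by
    have h1 : yElt K p t q N ∈ Q'.comap (normMap K p t q N).toRingHom := by
      rw [h]; exact yElt_mem_QIdeal K p t q N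
    rw [Ideal.mem_comap, AlgHom.toRingHom_eq_coe, RingHom.coe_coe, normMap_yElt] at h1
    exact hQ'.mem_of_pow_mem N h1
  have hle : QIdeal K p t q 1 ≤ Q' := by
    rw [QIdeal_one_eq_span, Ideal.span_le, Set.singleton_subset_iff]
    exact hy
  exact ((QIdeal_isMaximal K p t q ht Nat.one_pos).eq_of_le hQ'.ne_top hle).symm

end Curves

/-! ## §6 After a base change `K → L` with `t = τ^p`: the cusp `w^q = (x − τ)^p` -/

section Ext

variable (K : Type) [Field K] (p : ℕ) (t : K) (q : ℕ) (L : Type) [Field L] [Algebra K L] (τ : L)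

/-- `f_L = X₀^q − X₁^p + t ∈ L[X₀,X₁]`, the image of `f_1`. [folklore] -/
def twistPolyExt : MvPolynomial (Fin 2) L :=
  MvPolynomial.map (algebraMap K L) (twistPoly K p t q 1)

/-- `A_{1,L} = L[X₀,X₁]/(f_L)`. [folklore] -/
abbrev TwistRingExt : Type := MvPolynomial (Fin 2) L ⧸ Ideal.span {twistPolyExt K p t q L}

/-- The `L`-point `(0, τ)`. [folklore] -/
def cuspPt : Fin 2 → L := ![0, τ]

/-- `f_L = X₀^q − (X₁^p − t)` with `t` read in `L`. [folklore] -/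
theorem twistPolyExt_eq : twistPolyExt K p t q L =
    MvPolynomial.X 0 ^ q - (MvPolynomial.X 1 ^ p - MvPolynomial.C (algebraMap K L t)) := by
  simp [twistPolyExt, twistPoly, MvPolynomial.map_X, MvPolynomial.map_C]

variable {L τ} in
/-- `f_L(0, τ) = 0` when `τ^p = t`. [folklore] -/
theorem eval_cuspPt_twistPolyExt [hq : Fact q.Prime] (hτ : τ ^ p = algebraMap K L t) :
    MvPolynomial.eval (cuspPt L τ) (twistPolyExt K p t q L) = 0 := by
  rw [twistPolyExt_eq]
  simp [cuspPt, hτ, zero_pow hq.out.ne_zero]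

variable {L τ} in
/-- `∇f_L(0, τ) = 0`: `∂f/∂X₀ = q X₀^{q−1}` vanishes at `X₀ = 0` (`q ≥ 2`), and
`∂f/∂X₁ = −p X₁^{p−1} = 0` because `p = 0` in `L`. [folklore] -/
theorem eval_cuspPt_pderiv [hq : Fact q.Prime] [CharP K p] (i : Fin 2) :
    MvPolynomial.eval (cuspPt L τ) (MvPolynomial.pderiv i (twistPolyExt K p t q L)) = 0 := by
  haveI : CharP L p := charP_of_injective_algebraMap (algebraMap K L).injective p
  have hq1 : q - 1 ≠ 0 := by have := hq.out.two_le; omega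
  rw [twistPolyExt_eq]
  fin_cases i
  · simp [cuspPt, Derivation.leibniz_pow, zero_pow hq1]
  · simp [cuspPt, Derivation.leibniz_pow]

/-- `f_L ≠ 0` (its value at `(1, τ)` is `1` when `τ^p = t`). [folklore] -/
theorem twistPolyExt_ne_zero (hτ : τ ^ p = algebraMap K L t) : twistPolyExt K p t q L ≠ 0 := by
  intro h
  have := congrArg (MvPolynomial.eval ![1, τ]) h
  rw [twistPolyExt_eq] at this
  simp [hτ] at this

/-- `(f_L) ≤ 𝔪_{(0,τ)} = ker (eval (0, τ))`. [folklore] -/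
theorem span_twistPolyExt_le [Fact q.Prime] (hτ : τ ^ p = algebraMap K L t) :
    Ideal.span {twistPolyExt K p t q L} ≤ RingHom.ker (MvPolynomial.eval (cuspPt L τ)) :=
  (Ideal.span_singleton_le_iff_mem _).mpr (eval_cuspPt_twistPolyExt K p t q hτ)

/-- The cusp `(0, τ)` of `A_{1,L}` as a prime ideal. [folklore] -/
abbrev cuspIdeal : Ideal (TwistRingExt K p t q L) :=
  (RingHom.ker (MvPolynomial.eval (cuspPt L τ))).map (Ideal.Quotient.mk _)

/-- For `I ≤ Q`: the preimage of `Q/I` is `Q`. [folklore] -/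
theorem comap_map_mk_eq_of_le' {A : Type*} [CommRing A] (I Q : Ideal A) (hIQ : I ≤ Q) :
    (Q.map (Ideal.Quotient.mk I)).comap (Ideal.Quotient.mk I) = Q := by
  rw [Ideal.comap_map_of_surjective _ Ideal.Quotient.mk_surjective, ← RingHom.ker_eq_comap_bot,
    Ideal.mk_ker, sup_eq_left.mpr hIQ]

/-- The cusp ideal is prime. [folklore] -/
theorem cuspIdeal_isPrime [Fact q.Prime] (hτ : τ ^ p = algebraMap K L t) :
    (cuspIdeal K p t q L τ).IsPrime :=
  haveI := RingHom.ker_isPrime (MvPolynomial.eval (cuspPt L τ))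
  Ideal.map_isPrime_of_surjective Ideal.Quotient.mk_surjective
    (by rw [Ideal.mk_ker]; exact span_twistPolyExt_le K p t q L τ hτ)

/-- **The cusp is a non-regular point**: the local ring of `A_{1,L} = L[x,w]/(w^q − (x − τ)^p)` at
`(0, τ)` is not a regular local ring (Jacobian criterion, singular direction). [folklore] -/
theorem not_isRegularLocalRing_cusp [Fact q.Prime] [CharP K p]
    (hτ : τ ^ p = algebraMap K L t) :
    haveI := cuspIdeal_isPrime K p t q L τ hτ
    ¬ IsRegularLocalRing (Localization.AtPrime (cuspIdeal K p t q L τ)) := by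
  haveI := cuspIdeal_isPrime K p t q L τ hτ
  exact Literature.AlgebraicGeometry.Resolution.not_isRegularLocalRing_localization_of_pderiv_eval_eq_zero
    (cuspPt L τ) (twistPolyExt_ne_zero K p t q L τ hτ) (eval_cuspPt_twistPolyExt K p t q hτ)
    (eval_cuspPt_pderiv K p t q) (cuspIdeal K p t q L τ)
    (comap_map_mk_eq_of_le' _ _ (span_twistPolyExt_le K p t q L τ hτ))

/-- The base-change map `A_1 → A_{1,L}` (induced by `K[X₀,X₁] → L[X₀,X₁]`). [folklore] -/
def baseChangeHom : TwistRing K p t q 1 →+* TwistRingExt K p t q L :=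
  Ideal.quotientMap (Ideal.span {twistPolyExt K p t q L}) (MvPolynomial.map (algebraMap K L)) (by
    rw [Ideal.span_singleton_le_iff_mem, Ideal.mem_comap]
    exact Ideal.subset_span rfl)

/-- `baseChangeHom` on representatives. [folklore] -/
theorem baseChangeHom_mk (x : MvPolynomial (Fin 2) K) :
    baseChangeHom K p t q L (Ideal.Quotient.mk _ x) =
      Ideal.Quotient.mk _ (MvPolynomial.map (algebraMap K L) x) := by
  simp [baseChangeHom]

/-- Evaluation at `(0, τ)` factors through evaluation at `(0, t^{1/p})` when `τ^p = t`. [folklore] -/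
theorem aeval_cuspPt_eq_zero_of_mem_pointIdeal (hτ : τ ^ p = algebraMap K L t)
    {x : MvPolynomial (Fin 2) K} (hx : x ∈ pointIdeal K p t) :
    MvPolynomial.aeval (cuspPt L τ) x = 0 := by
  have hroot : (X ^ p - C t : K[X]).eval₂ (algebraMap K L) τ = 0 := by
    simp [hτ]
  let ψ : AdjoinRoot (X ^ p - C t : K[X]) →ₐ[K] L :=
    AdjoinRoot.liftAlgHom (X ^ p - C t : K[X]) (Algebra.ofId K L) τ (by simpa using hroot)
  have hcomp : (MvPolynomial.aeval (cuspPt L τ) : MvPolynomial (Fin 2) K →ₐ[K] L) =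
      ψ.comp (pointHom K p t) := by
    rw [pointHom, MvPolynomial.comp_aeval]
    congr 1
    ext i : 1
    fin_cases i
    · simp [cuspPt]
    · simp [cuspPt, ψ]
  rw [hcomp, AlgHom.comp_apply]
  have hx' : pointHom K p t x = 0 := hx
  rw [hx', map_zero]

/-- **The cusp lies over `Q_1`**: the non-regular point of `A_{1,L}` maps to the point `P_1` of
`A_1` (where, for `t ∉ K^p`, the curve `y^q = x^p − t` is regular). [folklore] -/
theorem comap_baseChangeHom_cuspIdeal [Fact q.Prime] (ht : Irreducible (X ^ p - C t : K[X]))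
    (hτ : τ ^ p = algebraMap K L t) :
    (cuspIdeal K p t q L τ).comap (baseChangeHom K p t q L) = QIdeal K p t q 1 := by
  haveI := cuspIdeal_isPrime K p t q L τ hτ
  symm
  refine (QIdeal_isMaximal K p t q ht Nat.one_pos).eq_of_le (Ideal.IsPrime.ne_top inferInstance) ?_
  rw [QIdeal, Ideal.map_le_iff_le_comap, Ideal.comap_comap]
  intro x hx
  rw [Ideal.mem_comap]
  have hcomp : (baseChangeHom K p t q L).comp (Ideal.Quotient.mk (Ideal.span {twistPoly K p t q 1})) =
      (Ideal.Quotient.mk (Ideal.span {twistPolyExt K p t q L})).comp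
        (MvPolynomial.map (algebraMap K L)) := by
    ext <;> simp [baseChangeHom]
  rw [hcomp, RingHom.comp_apply]
  apply Ideal.mem_map_of_mem
  rw [RingHom.mem_ker, MvPolynomial.eval_map, ← MvPolynomial.aeval_def]
  exact aeval_cuspPt_eq_zero_of_mem_pointIdeal K p t L τ hτ hx

/-- **`A_{1,L} = A_1 ⊗_K L`**: the explicit `L`-free ring isomorphism (Mathlib's
`Algebra.TensorProduct.tensorQuotientEquiv` with `MvPolynomial.algebraTensorAlgEquiv`, after
`TensorProduct.comm`). [folklore] -/
def tensorEquivL : L ⊗[K] TwistRing K p t q 1 ≃ₐ[L] TwistRingExt K p t q L :=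
  (Algebra.TensorProduct.tensorQuotientEquiv (R := K) L (MvPolynomial (Fin 2) K) L
      (Ideal.span {twistPoly K p t q 1})).trans
    (Ideal.quotientEquivAlg _ _ (MvPolynomial.algebraTensorAlgEquiv K L) (by
      rw [Ideal.map_span, Set.image_singleton, Ideal.map_span, Set.image_singleton]
      congr 1
      ext1
      simp [twistPolyExt, Algebra.TensorProduct.includeRight_apply]))

/-- Under `L ⊗_K A_1 ≅ A_{1,L}`, `1 ⊗ a ↦ baseChangeHom a`. [folklore] -/
theorem tensorEquivL_one_tmul (a : TwistRing K p t q 1) :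
    tensorEquivL K p t q L (1 ⊗ₜ a) = baseChangeHom K p t q L a := by
  obtain ⟨x, rfl⟩ := Ideal.Quotient.mk_surjective a
  simp [tensorEquivL, baseChangeHom]

/-- The ring isomorphism `A_1 ⊗_K L ≅ A_{1,L}` (factors swapped, as delivered by `pullbackSpecIso`).
[folklore] -/
def tensorEquiv : TwistRing K p t q 1 ⊗[K] L ≃+* TwistRingExt K p t q L :=
  (Algebra.TensorProduct.comm K (TwistRing K p t q 1) L).toRingEquiv.trans (tensorEquivL K p t q L).toRingEquiv

/-- Under `A_1 ⊗_K L ≅ A_{1,L}`, `a ⊗ 1 ↦ baseChangeHom a`. [folklore] -/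
theorem tensorEquiv_tmul_one (a : TwistRing K p t q 1) :
    tensorEquiv K p t q L (a ⊗ₜ 1) = baseChangeHom K p t q L a := by
  rw [← tensorEquivL_one_tmul]
  simp [tensorEquiv]

/-- `tensorEquiv ∘ includeLeft = baseChangeHom`. [folklore] -/
theorem tensorEquiv_comp_includeLeft :
    (tensorEquiv K p t q L).toRingHom.comp
        (Algebra.TensorProduct.includeLeftRingHom : TwistRing K p t q 1 →+* TwistRing K p t q 1 ⊗[K] L) =
      baseChangeHom K p t q L := by
  ext a
  · simp [tensorEquiv_tmul_one]
  · simp [tensorEquiv_tmul_one]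

end Ext




end Summit.ResolutionOfSingularities.ResolutionOfSingularities.Theorems.CampaignW82.TwistExponent

end
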